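import Literature.Barriers.ValiantsHypothesis.FullRankMultilinearFormulaLowerBound
import Literature.Barriers.ValiantsHypothesis.FullRankMultilinearFormulaBridge
import Literature.Barriers.ValiantsHypothesis.FullRankMultilinearFormulaSyntactic
import Summits.ValiantsHypothesis.ValiantsHypothesis.Theorems.BarrierLeverDefinableEquationsFullRankMethod

/-!
# Route BarrierLever — the MODEL axis of crux `DefinableEquations` (stmt-8745) / item
# `SingleSizeEquations` (stmt-8749): NATURAL PROOFS AGAINST SYNTACTICALLY MULTILINEAR FORMULAS OF
# EVERY POLYNOMIAL SIZE, AT ONE LEVEL (Raz's `n^{Ω(log n)}` method made FSV-natural; val-np-p5 g9)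

Composition of `FullRankMethod.not_isSuccinctHittingSet_not_isFullRank` (the full-rank method is an
algebraically natural proof: the product `E_n` of the `C(2n,n)` cut determinants, size/degree
`≤ C(4n,2n)^5`, `q = 0`) with the TREE THEOREM
`RazFormula.not_isFullRank_of_syntMultilinear` (`Literature/…/FullRankMultilinearFormulaLowerBound.lean`,
Raz 2006 Cor. 3.6 in polynomial form, proved in the tree this session: for every `b`, eventually
in `n`, no syntactically multilinear formula of size `≤ n^b` over `2n` variables computes a
full-rank polynomial):

* `naturalProofsAgainstMultilinearFormulas` — for every `b` there is `n₀` such that for all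
  `n ≥ n₀` the polynomials computed by syntactically multilinear formulas (tree type `WExpr`,
  fan-in-two weighted sums and products) of size `≤ n^b` over `2n` variables are NOT a succinct
  hitting set for `Distinguishers ℂ (2n) 5`;
* `naturalProofsAgainstMultilinearFormulas_uniform` — the `∃ a ∀ b` form (`a = 5`): the quantifier
  shape of crux `DefinableEquations` on this slice — a SUPER-POLYNOMIAL lower-bound method for an
  UNBOUNDED-DEPTH syntactic model, the last classical one missing from the model axis;
* `multilinearFormulaSliceEquations` — the crux's `q = 0` Boolean-sum rendering;
* `…_smallCircuits` — the sub-slice of `SmallCircuits ℂ (2n) b'`.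

Place on the chart (model axis of 8745/8749): general circuits — every LINEAR size, `n²` OPEN
(the crux); syntactically multilinear CIRCUITS — size `< c n²/log² n`
(`…FullRankMethodMultilinearCircuits.lean`, AKV); syntactically multilinear FORMULAS — EVERY
polynomial size `n^b` at the fixed level `5` (this file).  What this is NOT: formulas here are
SYNTACTICALLY multilinear trees (`RazFormula.IsSyntMultilinear`); the reduction from semantically
multilinear formulas (Raz 2006 Prop. 2.1) and the bridge to the tree's `formulaComplexity` are not
formalised; nothing on general circuits or formulas of size `n²` (the crux, OPEN) or on `VP ≠ VNP`.
No definitions, no named facts; standard axioms.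
Refs: Raz, Theory of Computing 2 (2006) Cor. 3.6; Forbes–Shpilka–Volk 2018 Def. 1/3, Thm. 4.
-/

-- `Summit.ValiantsHypothesis.ValiantsHypothesis.…` repeats a component by the D-0017 layout
-- (single-conjunct summit), which the `dupNamespace` linter flags; the name is mandated.
set_option linter.dupNamespace false

noncomputable section

namespace Summit.ValiantsHypothesis.ValiantsHypothesis.Theorems.BarrierLeverDefinableEquations

open MvPolynomial
open Literature.Computability.AlgebraicComplexity hiding smCircuitSize IsSyntacticallyMultilinear
open Literature.Barriers.ValiantsHypothesis
open Literature.Barriers.ValiantsHypothesis.RazFormula (IsSyntMultilinear not_isFullRank_of_syntMultilinear)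
open scoped BigOperators

namespace FullRankMethod

/-- **NATURAL PROOFS AGAINST SYNTACTICALLY MULTILINEAR FORMULAS OF SIZE `n^b`, FOR EVERY `b`, AT
LEVEL `5`** (Raz's method made FSV-natural, regime `d = n`).  For every `b` there is `n₀` such that
for all `n ≥ n₀` the polynomials `g ∈ ℂ[x_1, …, x_{2n}]` computed by a syntactically multilinear
formula of size `≤ n^b` are NOT a succinct hitting set for `Distinguishers ℂ (2n) 5`: the full-rank
equation `E_n` is nonzero and vanishes on all of them, because none of them is of full rank.
[cite: Raz2006, Cor. 3.6] [cite: ForbesShpilkaVolk2018, Thm. 4] -/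
theorem naturalProofsAgainstMultilinearFormulas (b : ℕ) :
    ∃ n₀ : ℕ, ∀ n : ℕ, n₀ ≤ n →
      ¬ IsSuccinctHittingSet (degLEMonomials (2 * n))
        {g : MvPolynomial (Fin (2 * n)) ℂ | ∃ e : WExpr ℂ (Fin (2 * n)),
          IsSyntMultilinear e ∧ e.eval = g ∧ e.size ≤ n ^ b}
        (Distinguishers ℂ (2 * n) 5) := by
  obtain ⟨n₁, h₁⟩ := not_isFullRank_of_syntMultilinear (K := ℂ) b
  refine ⟨max n₁ 11, fun n hn h => not_isSuccinctHittingSet_not_isFullRank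
    (le_trans (le_max_right _ _) hn) (h.mono ?_ le_rfl)⟩
  rintro g ⟨e, he, rfl, hsize⟩
  exact h₁ n (le_trans (le_max_left _ _) hn) e he hsize

/-- **The `∃ a ∀ b` form** (the quantifier shape of crux `DefinableEquations` on the slice): ONE
level, `a = 5`, serves every formula-size exponent `b`. [cite: Raz2006, Cor. 3.6] [cite: ForbesShpilkaVolk2018, Thm. 4] -/
theorem naturalProofsAgainstMultilinearFormulas_uniform :
    ∃ a : ℕ, ∀ b : ℕ, ∃ n₀ : ℕ, ∀ n : ℕ, n₀ ≤ n →
      ¬ IsSuccinctHittingSet (degLEMonomials (2 * n))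
        {g : MvPolynomial (Fin (2 * n)) ℂ | ∃ e : WExpr ℂ (Fin (2 * n)),
          IsSyntMultilinear e ∧ e.eval = g ∧ e.size ≤ n ^ b}
        (Distinguishers ℂ (2 * n) a) :=
  ⟨5, naturalProofsAgainstMultilinearFormulas⟩

/-- **The sub-slice of `SmallCircuits ℂ (2n) b'`** (any `b'`): the members of
`SmallCircuits ℂ (2n) b'` with a syntactically multilinear formula of size `≤ n^b` are not a
succinct hitting set for `Distinguishers ℂ (2n) 5` either (a subclass). [cite: Raz2006, Cor. 3.6] -/
theorem naturalProofsAgainstMultilinearFormulas_smallCircuits (b b' : ℕ) :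
    ∃ n₀ : ℕ, ∀ n : ℕ, n₀ ≤ n →
      ¬ IsSuccinctHittingSet (degLEMonomials (2 * n))
        {g : MvPolynomial (Fin (2 * n)) ℂ | g ∈ SmallCircuits ℂ (2 * n) b' ∧
          ∃ e : WExpr ℂ (Fin (2 * n)), IsSyntMultilinear e ∧ e.eval = g ∧ e.size ≤ n ^ b}
        (Distinguishers ℂ (2 * n) 5) := by
  obtain ⟨n₀, h⟩ := naturalProofsAgainstMultilinearFormulas b
  refine ⟨n₀, fun n hn hS => h n hn (hS.mono ?_ le_rfl)⟩
  rintro g ⟨-, he⟩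
  exact he

/-- **The crux's `q = 0` Boolean-sum rendering**: for every `b`, eventually in `n`, a datum `H`
with `L(H), deg H ≤ C(4n,2n)^5` and `boolSum H ≠ 0` vanishes at `coeff(g)` for every `g` computed
by a syntactically multilinear formula of size `≤ n^b` — `SingleSizeEquations` (at `2n`
variables, fixed level `a = 5` for all `b`) with `SmallCircuits` replaced by this slice.
[cite: Raz2006, Cor. 3.6] [cite: ForbesShpilkaVolk2018, Def. 1] -/
theorem multilinearFormulaSliceEquations (b : ℕ) :
    ∃ n₀ : ℕ, ∀ n : ℕ, n₀ ≤ n →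
      ∃ q : ℕ, q ≤ Nat.choose (2 * (2 * n)) (2 * n) ^ 5 ∧
        ∃ H : MvPolynomial (↥(degLEMonomials (2 * n)) ⊕ Fin q) ℂ,
          complexity H ≤ Nat.choose (2 * (2 * n)) (2 * n) ^ 5 ∧
          H.totalDegree ≤ Nat.choose (2 * (2 * n)) (2 * n) ^ 5 ∧ boolSum H ≠ 0 ∧
          ∀ g : MvPolynomial (Fin (2 * n)) ℂ,
            (∃ e : WExpr ℂ (Fin (2 * n)), IsSyntMultilinear e ∧ e.eval = g ∧ e.size ≤ n ^ b) →
            eval (coeffVector (degLEMonomials (2 * n)) g) (boolSum H) = 0 := by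
  obtain ⟨n₀, Hn⟩ := naturalProofsAgainstMultilinearFormulas b
  refine ⟨n₀, fun n hn => ?_⟩
  obtain ⟨D, hD, hD0, hvan⟩ := (exists_isNaturalProof_iff _ _ _).mpr (Hn n hn)
  have hbs : boolSum (m := 0) (MvPolynomial.rename Sum.inl D) = D := by
    rw [boolSum, Fintype.sum_unique, MvPolynomial.aeval_rename, Sum.elim_comp_inl,
      MvPolynomial.aeval_X_left, AlgHom.coe_id, id_eq]
  refine ⟨0, Nat.zero_le _, MvPolynomial.rename Sum.inl D, ?_, ?_, ?_, fun g hg => ?_⟩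
  · exact (complexity_rename_le_holds' _ _).trans hD.1
  · exact (MvPolynomial.totalDegree_rename_le _ _).trans hD.2
  · rwa [hbs]
  · rw [hbs]; exact hvan g hg

/-! ### Appendix (val-np-p5 g9): the same slice in the circuit vocabulary -/

/-- **The multilinear-formula slice in the tree's circuit vocabulary**: for every `b` there is `n₀`
such that for all `n ≥ n₀` the polynomials computed by a fan-in-two syntactically multilinear
FORMULA of the circuit model (`ArithCircuit.IsFormula ∧ IsFanInTwo ∧ IsSyntacticallyMultilinear`)
with `≤ n^b` gates over `2n` variables are NOT a succinct hitting set for `Distinguishers ℂ (2n) 5`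
(such a formula unfolds to a syntactically multilinear tree of size `≤ n^b`:
`RazFormula.isSyntMultilinear_toWExpr`, `ArithCircuit.size_toWExpr_le`, `ArithCircuit.eval_toWExpr`).
[cite: Raz2006, Cor. 3.6] [cite: ForbesShpilkaVolk2018, Thm. 4] -/
theorem naturalProofsAgainstMultilinearFormulas_circuit (b : ℕ) :
    ∃ n₀ : ℕ, ∀ n : ℕ, n₀ ≤ n →
      ¬ IsSuccinctHittingSet (degLEMonomials (2 * n))
        {g : MvPolynomial (Fin (2 * n)) ℂ | ∃ P : ArithCircuit ℂ (Fin (2 * n)), P.IsFormula ∧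
          P.IsFanInTwo ∧ Literature.Barriers.ValiantsHypothesis.IsSyntacticallyMultilinear P ∧
          P.Computes g ∧ P.size ≤ n ^ b}
        (Distinguishers ℂ (2 * n) 5) := by
  obtain ⟨n₀, h⟩ := naturalProofsAgainstMultilinearFormulas b
  refine ⟨n₀, fun n hn hS => h n hn (hS.mono ?_ le_rfl)⟩
  rintro g ⟨P, hf, h2, hsm, hPg, hsize⟩
  refine ⟨P.toWExpr, RazFormula.isSyntMultilinear_toWExpr hsm, ?_, (ArithCircuit.size_toWExpr_le hf h2).trans hsize⟩
  rw [ArithCircuit.eval_toWExpr]; exact hPg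

/-- **`∃ a ∀ b` in the circuit vocabulary**: ONE level `a = 5` for every formula-size exponent `b`.
[cite: Raz2006, Cor. 3.6] -/
theorem naturalProofsAgainstMultilinearFormulas_circuit_uniform :
    ∃ a : ℕ, ∀ b : ℕ, ∃ n₀ : ℕ, ∀ n : ℕ, n₀ ≤ n →
      ¬ IsSuccinctHittingSet (degLEMonomials (2 * n))
        {g : MvPolynomial (Fin (2 * n)) ℂ | ∃ P : ArithCircuit ℂ (Fin (2 * n)), P.IsFormula ∧
          P.IsFanInTwo ∧ Literature.Barriers.ValiantsHypothesis.IsSyntacticallyMultilinear P ∧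
          P.Computes g ∧ P.size ≤ n ^ b}
        (Distinguishers ℂ (2 * n) a) :=
  ⟨5, naturalProofsAgainstMultilinearFormulas_circuit⟩

/-! ### Appendix 2 (val-np-p5 g9): MULTILINEAR formulas (Raz 2006 Prop. 2.1) -/

/-- **Natural proofs against MULTILINEAR formulas of every polynomial size, at level 5.**  For every
`b` there is `n₀` such that for all `n ≥ n₀` the polynomials computed by a MULTILINEAR formula (every
node computes a multilinear polynomial, `RazFormula.IsMultilinearFormula`; made syntactically
multilinear of the same size by Raz's Prop. 2.1, `RazFormula.exists_syntMultilinear`) of size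
`≤ n^b` over `2n` variables are NOT a succinct hitting set for `Distinguishers ℂ (2n) 5`.
[cite: Raz2006, Prop. 2.1 and Cor. 3.6] [cite: ForbesShpilkaVolk2018, Thm. 4] -/
theorem naturalProofsAgainstMultilinearFormulas_semantic (b : ℕ) :
    ∃ n₀ : ℕ, ∀ n : ℕ, n₀ ≤ n →
      ¬ IsSuccinctHittingSet (degLEMonomials (2 * n))
        {g : MvPolynomial (Fin (2 * n)) ℂ | ∃ e : WExpr ℂ (Fin (2 * n)),
          RazFormula.IsMultilinearFormula e ∧ e.eval = g ∧ e.size ≤ n ^ b}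
        (Distinguishers ℂ (2 * n) 5) := by
  obtain ⟨n₀, h⟩ := naturalProofsAgainstMultilinearFormulas b
  refine ⟨n₀, fun n hn hS => h n hn (hS.mono ?_ le_rfl)⟩
  rintro g ⟨e, he, rfl, hsize⟩
  obtain ⟨e', hs, hev, hsz⟩ := RazFormula.exists_syntMultilinear he
  exact ⟨e', hs, hev, hsz.trans hsize⟩

/-- **`∃ a ∀ b` for multilinear formulas**: ONE level `a = 5` for every formula-size exponent `b`.
[cite: Raz2006, Cor. 3.6] -/
theorem naturalProofsAgainstMultilinearFormulas_semantic_uniform :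
    ∃ a : ℕ, ∀ b : ℕ, ∃ n₀ : ℕ, ∀ n : ℕ, n₀ ≤ n →
      ¬ IsSuccinctHittingSet (degLEMonomials (2 * n))
        {g : MvPolynomial (Fin (2 * n)) ℂ | ∃ e : WExpr ℂ (Fin (2 * n)),
          RazFormula.IsMultilinearFormula e ∧ e.eval = g ∧ e.size ≤ n ^ b}
        (Distinguishers ℂ (2 * n) a) :=
  ⟨5, naturalProofsAgainstMultilinearFormulas_semantic⟩

end FullRankMethod

end Summit.ValiantsHypothesis.ValiantsHypothesis.Theorems.BarrierLeverDefinableEquations
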